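import Mathlib
import HarnessLib
import Summits.HubbardSuperconductivity.HubbardSuperconductivity.Theorems.KLProgrammeH10TwoPointLimitFramePerturbation
import Summits.HubbardSuperconductivity.HubbardSuperconductivity.Theorems.KLProgrammeH10TwoPointLimitPerturbedFermiRadiusSmooth
import Summits.HubbardSuperconductivity.HubbardSuperconductivity.Theorems.KLProgrammeKLRegimeSplitTwoLegF

/-!
# Route `KLProgramme` — crux K1 `H10TwoPointLimit` (stmt-HubbardSuperconductivity-19938) / K3's children:
# the frame's Fermi-point map `θ ↦ klFermiPoint μ K θ` is `C^∞`, and so is every frame read on the frame's own Fermi curve —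
# the frame-side half of (E3g) `TwoLegAngularG` (`ContDiff ℝ 4 (klLocalPart …)`), stated ONCE for the engine and child 2

Cell `gate-hubbard-kl`, seat p4 (C5a lead), g5 — plan g10 2026-08-26T17:26:06Z (2): «if `ContDiff ℝ 4 (klLocalPart …)` needs the frame's
curve map C⁴ (implicit-function smoothness of `klFermiPoint μ K ·` …), that lemma is CHILD-2/FRAME-SIDE work (k3c3-*, p4 lineage's
PerturbedFermiCurve files), stated once and cited by the engine»; referee WATCH W-(E3g)-1 (ref-4 18:40Z): `klFermiPoint` is built on
`perturbedFermiRadius = Classical.epsilon` (junk off-window) ⇒ the `ContDiff` conjunct is provable only via the unique-root/IFT lemma.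
This file is that lemma.  For a frame `K` of `C²` size `A` (`‖Dʲ(frameShift K)‖ ≤ A`, `j ≤ 2`; e.g. from `FrameGeometry`/`FrameOK`,
`KLProgrammeH10TwoPointLimitFramePerturbation.lean`) with `2A < Dt_min` and `[μ − A, μ + A]` inside a level range `[a, b] ⊂ (-4, 0)`
carrying `B : BandBounds a b`:

* §1 `klFermiPoint μ K θ = perturbedFermiRadius δ_K μ θ • dir θ` with `δ_K = frameShift K ∘ toLp` (`rfl`), and the canonical radius IS
  a root selection (`isBandFermiRadius_klFermiRadius`), so the lineage's implicit-function theorem `contDiff_of_isRoot` (BGM 2006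
  Lemma 2.1, `…PerturbedFermiRadiusSmooth`) applies with `δ_K ∈ C^∞`: **`contDiff_klFermiRadius`, `contDiff_klFermiPoint`** (`C^∞` in
  the angle), with the first-order bound `|u_K'| ≤ (4 + 2A)·u_K/(Dt_min − 2A)` (`abs_deriv_klFermiRadius_le`).
* §2 every frame read on the curve is `C^∞`: `contDiff_eval_klFermiPoint` (`θ ↦ A'.eval (klFermiPoint μ K θ)` for ANY
  `A' : TrigPolyC4v`), hence **`contDiff_klLocalPart`**: `ContDiff ℝ m (klLocalPart L M β U μ K n)` for every `m : ℕ∞` — in particular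
  the `ContDiff ℝ 4` conjunct of (E3g) — with NO hypothesis on the model (the local part is a trigonometric interpolant read on the curve).
* §3 keyed by the cell's predicate in the KL regime: `contDiff_klLocalPart_of_frameOK` — for every `R` (`Gfr ≥ 0`) there are
  `c₃, U₀ > 0` such that for `0 < c ≤ c₃`, `0 < U ≤ U₀`, `klBetaMin ≤ β ≤ e^{c/U²}`, every `μ ∈ klWindowC` and every frame admissible at
  depth `nScales β` (`FrameOK R U (nScales β) ν K`, any `ν`), `klFermiPoint μ K` and `klLocalPart L M β U μ K n` are `C^∞` (`Dt_min` of
  `bandBounds (-1.1) (-0.1)`, margin `1/20`).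

Everything is PROVED; no definitions, no named facts.  References: BGM 2006 §2.4 Lemma 2.1 (2.40) [cite: BenfattoGiulianiMastropietro2006];
HOME/prover-p4/INVERSION-NOTE.md Lemma I (ii); plan g10 STATUS 17:26:06Z (2).
-/

noncomputable section

namespace Summit.HubbardSuperconductivity.HubbardSuperconductivity.Theorems.PerturbedFermiCurve

set_option linter.dupNamespace false -- summit = problem name (single-conjunct summit), D-0017

open Classical
open Real Set
open Literature.MathematicalPhysics.QuantumLattice Literature.MathematicalPhysics.QuantumLattice.BandSectorCounting
open Summit.HubbardSuperconductivity.HubbardSuperconductivity.Theorems.DispersionFlow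
open Summit.HubbardSuperconductivity.HubbardSuperconductivity.Theorems.KLRegimeSplit

/-! ## §1 The frame's Fermi radius and Fermi point are `C^∞` in the angle -/

/-- `δ_K` in the two spellings: `frameShift K ∘ toLp = (p ↦ -K(p))` (definitional). -/
theorem frameShift_toLp_eq_neg_eval (K : TrigPolyC4v) :
    (fun k : Fin 2 → ℝ => frameShift K (WithLp.toLp 2 k)) = fun p => -K.eval p := rfl

/-- **`klFermiPoint` through the lineage's radius**: `klFermiPoint μ K θ = perturbedFermiRadius δ_K μ θ • dir θ`. -/
theorem klFermiPoint_eq (μ : ℝ) (K : TrigPolyC4v) (θ : ℝ) :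
    klFermiPoint μ K θ = perturbedFermiRadius (fun k : Fin 2 → ℝ => frameShift K (WithLp.toLp 2 k)) μ θ • dir θ := rfl

section Smooth

variable {a b : ℝ} (B : BandBounds a b) {K : TrigPolyC4v} {A : ℝ}
  (hA : ∀ p : Momentum, ∀ j ≤ 2, ‖iteratedFDeriv ℝ j (frameShift K) p‖ ≤ A) (hADt : 2 * A < B.Dtmin)
  {μ : ℝ} (hlo : a ≤ μ - A) (hhi : μ + A ≤ b)
include B hA hADt hlo hhi

omit hADt in
/-- **The canonical radius of the frame's curve is a root selection**: on every ray, `perturbedFermiRadius δ_K μ θ` is a Fermi point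
of `ε₀ + δ_K` at level `μ`. -/
theorem isBandFermiRadius_klFermiRadius (θ : ℝ) :
    IsBandFermiRadius (μ - (fun p : Fin 2 → ℝ => -K.eval p) (perturbedFermiRadius (fun p : Fin 2 → ℝ => -K.eval p) μ θ • dir θ)) θ
      (perturbedFermiRadius (fun p : Fin 2 → ℝ => -K.eval p) μ θ) :=
  isBandFermiRadius_perturbedFermiRadius_frame B hA hlo hhi θ

/-- **The frame's Fermi radius `θ ↦ u_K(θ)` is `C^∞`** (BGM 2006 Lemma 2.1 / the lineage's `contDiff_of_isRoot` with `δ_K ∈ C^∞`,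
`|δ_K| ≤ A`, `‖Dδ_K‖ ≤ 2A < Dt_min`). [cite: BenfattoGiulianiMastropietro2006, §2.4 Lemma 2.1 (2.40)] -/
theorem contDiff_klFermiRadius {m : ℕ∞} :
    ContDiff ℝ m (perturbedFermiRadius (fun p : Fin 2 → ℝ => -K.eval p) μ) := by
  have hC : ContDiff ℝ ((⊤ : ℕ∞) : WithTop ℕ∞) (fun p : Fin 2 → ℝ => -K.eval p) := by
    rw [← frameShift_toLp_eq_neg_eval]; exact contDiff_frameShift_toLp K
  have hδ : ∀ k : Fin 2 → ℝ, (∀ i, |k i| ≤ π) → |(fun p : Fin 2 → ℝ => -K.eval p) k| ≤ A := fun k _ => by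
    simpa [frameShift_toLp] using abs_frameShift_toLp_le hA k
  have hκ : ∀ k : Fin 2 → ℝ, (∀ i, |k i| ≤ π) → ‖fderiv ℝ (fun p : Fin 2 → ℝ => -K.eval p) k‖ ≤ 2 * A := fun k _ => by
    rw [← frameShift_toLp_eq_neg_eval]; exact norm_fderiv_frameShift_toLp_le hA k
  have h := contDiff_of_isRoot B hC (by simp) hδ hlo hhi hκ hADt (isBandFermiRadius_klFermiRadius B hA hlo hhi)
  exact h.of_le (by exact_mod_cast le_top)

/-- **The frame's Fermi-point map `θ ↦ klFermiPoint μ K θ` is `C^∞`.** -/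
theorem contDiff_klFermiPoint {m : ℕ∞} : ContDiff ℝ m (klFermiPoint μ K) := by
  have h1 := contDiff_klFermiRadius B hA hADt hlo hhi (m := m)
  have h2 : ContDiff ℝ m dir := contDiff_dir
  exact h1.smul h2

/-- **First-order bound on the frame's Fermi radius**: `|u_K'(θ)| ≤ (4 + 2A)·u_K(θ)/(Dt_min − 2A)`. -/
theorem abs_deriv_klFermiRadius_le (θ : ℝ) :
    |deriv (perturbedFermiRadius (fun p : Fin 2 → ℝ => -K.eval p) μ) θ| ≤
      (4 + 2 * A) * perturbedFermiRadius (fun p : Fin 2 → ℝ => -K.eval p) μ θ / (B.Dtmin - 2 * A) := by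
  have hC : ContDiff ℝ 1 (fun p : Fin 2 → ℝ => -K.eval p) := by
    rw [← frameShift_toLp_eq_neg_eval]; exact contDiff_frameShift_toLp K
  have hδ : ∀ k : Fin 2 → ℝ, (∀ i, |k i| ≤ π) → |(fun p : Fin 2 → ℝ => -K.eval p) k| ≤ A := fun k _ => by
    simpa [frameShift_toLp] using abs_frameShift_toLp_le hA k
  have hκ : ∀ k : Fin 2 → ℝ, (∀ i, |k i| ≤ π) → ‖fderiv ℝ (fun p : Fin 2 → ℝ => -K.eval p) k‖ ≤ 2 * A := fun k _ => by
    rw [← frameShift_toLp_eq_neg_eval]; exact norm_fderiv_frameShift_toLp_le hA k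
  exact abs_deriv_le B hC (by simp) hδ hlo hhi hκ hADt (isBandFermiRadius_klFermiRadius B hA hlo hhi) θ

omit hADt in
/-- The frame's Fermi point lies on the frame's curve: `frameLevel μ K (toLp (klFermiPoint μ K θ)) = 0`. -/
theorem frameLevel_klFermiPoint (θ : ℝ) : frameLevel μ K (WithLp.toLp 2 (klFermiPoint μ K θ)) = 0 :=
  frameLevel_perturbedFermiRadius_eq_zero B hA hlo hhi θ

/-! ## §2 Every frame read on the frame's curve is `C^∞`; the local part -/

/-- **A frame read on the frame's Fermi curve is `C^∞` in the angle**: `θ ↦ A'(klFermiPoint μ K θ)` for ANY `A' : TrigPolyC4v`. -/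
theorem contDiff_eval_klFermiPoint (A' : TrigPolyC4v) {m : ℕ∞} :
    ContDiff ℝ m (fun θ : ℝ => A'.eval (klFermiPoint μ K θ)) := by
  have h1 : ContDiff ℝ m (fun p : Fin 2 → ℝ => A'.eval p) := by
    have := (contDiff_frameShift_toLp A' (m := m)).neg
    simpa [frameShift_toLp] using this
  exact h1.comp (contDiff_klFermiPoint B hA hADt hlo hhi)

/-- **The two-leg local part read on the frame's own curve is `C^∞` in the angle** — the frame-side conjunct of (E3g)
`TwoLegAngularG` (`ContDiff ℝ 4 (klLocalPart L M β U μ K n)` is the case `m = 4`), for EVERY `(L, M, β, U, n)`: the local part is the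
trigonometric interpolant `symInterp L (klLocSelfEnergyRe …)` read at `klFermiPoint μ K θ`. -/
theorem contDiff_klLocalPart (L M : ℕ) [NeZero L] [NeZero M] (β U : ℝ) (n : ℕ) {m : ℕ∞} :
    ContDiff ℝ m (klLocalPart L M β U μ K n) := by
  unfold klLocalPart
  exact contDiff_eval_klFermiPoint B hA hADt hlo hhi _

/-- (E3g)'s first conjunct verbatim: `ContDiff ℝ 4 (klLocalPart L M β U μ K n)`. -/
theorem contDiff_four_klLocalPart (L M : ℕ) [NeZero L] [NeZero M] (β U : ℝ) (n : ℕ) :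
    ContDiff ℝ 4 (klLocalPart L M β U μ K n) := by
  have h := contDiff_klLocalPart B hA hADt hlo hhi L M β U n (m := 4)
  exact_mod_cast h

end Smooth

/-! ## §3 In the KL regime, keyed by `FrameOK` on the covariance window `klWindowC` -/

/-- Arithmetic of the window: `klWindowC = [-1.05, -0.15]` sits inside `[-1.1, -0.1]` with margin `1/20`. -/
theorem klWindowC_margin {μ : ℝ} (hμ : μ ∈ klWindowC) {A : ℝ} (hA : A ≤ 1 / 20) :
    (-1.1 : ℝ) ≤ μ - A ∧ μ + A ≤ -0.1 := by
  obtain ⟨h1, h2⟩ := hμ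
  constructor <;> linarith

/-- **The frame's Fermi-point map and the local part are `C^∞` for every admissible frame in the KL regime.**  For every
renormalisation package `R` (`Gfr ≥ 0`) there are `c₃, U₀ > 0` such that for `0 < c ≤ c₃`, `0 < U ≤ U₀`, `klBetaMin ≤ β ≤ e^{c/U²}`,
every `μ ∈ klWindowC`, every frame `K` with `FrameOK R U (nScales β) ν K` (any `ν`): `klFermiPoint μ K` is `C^∞` and
`klLocalPart L M β U μ K n` is `C^∞` for all `(L, M, n)` — so (E3g)'s `ContDiff ℝ 4` conjunct holds on every admissible frame, cited,
not re-derived. [cite: BenfattoGiulianiMastropietro2006, §2.4 Lemma 2.1 (2.40)] -/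
theorem contDiff_klLocalPart_of_frameOK (R : RenConsts) (hR : ∀ j, 0 ≤ R.Gfr j) :
    ∃ c₃ : ℝ, 0 < c₃ ∧ ∃ U₀ : ℝ, 0 < U₀ ∧
      ∀ c : ℝ, 0 < c → c ≤ c₃ → ∀ U : ℝ, 0 < U → U ≤ U₀ → ∀ β : ℝ, klBetaMin ≤ β → β ≤ Real.exp (c / U ^ 2) →
      ∀ μ ∈ klWindowC, ∀ (ν : ℝ) (K : TrigPolyC4v), FrameOK R U (nScales β) ν K →
        (∀ m : ℕ∞, ContDiff ℝ m (klFermiPoint μ K)) ∧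
        ∀ (L M : ℕ) [NeZero L] [NeZero M] (n : ℕ) (m : ℕ∞), ContDiff ℝ m (klLocalPart L M β U μ K n) := by
  have ha : (-4 : ℝ) < -1.1 := by norm_num
  have hab : (-1.1 : ℝ) ≤ -0.1 := by norm_num
  have hb : (-0.1 : ℝ) < 0 := by norm_num
  set B := bandBounds ha hab hb with hBdef
  have hDt := B.Dtmin_pos
  set κ : ℝ := min B.Dtmin (1 / 5) with hκdef
  have hκ : 0 < κ := lt_min hDt (by norm_num)
  obtain ⟨c₃, hc₃, U₀, hU₀, hthr⟩ := frame_thresholds hR hκ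
  refine ⟨c₃, hc₃, U₀, hU₀, ?_⟩
  intro c hc hcle U hU hUle β hβmin hβc μ hμ ν K hK
  have hAf : ∀ p : Momentum, ∀ j ≤ 2, ‖iteratedFDeriv ℝ j (frameShift K) p‖ ≤
      2 * R.Gfr 0 * |U| + 2 * R.Gfr 1 * U ^ 2 + R.Gfr 2 * (c / Real.log 4) := fun p j hj =>
    norm_iteratedFDeriv_frameShift_le_of_frameOK_regime hR hc.le hβmin hβc hK p hj
  set A := 2 * R.Gfr 0 * |U| + 2 * R.Gfr 1 * U ^ 2 + R.Gfr 2 * (c / Real.log 4) with hAdef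
  have h4A : 4 * A ≤ κ := hthr c U hc.le hcle hU hUle
  have hADt : 2 * A < B.Dtmin := by
    have : κ ≤ B.Dtmin := min_le_left _ _
    have hA0 : 0 ≤ A := le_trans (norm_nonneg _) (hAf 0 0 (by norm_num))
    linarith
  have hA20 : A ≤ 1 / 20 := by
    have : κ ≤ 1 / 5 := min_le_right _ _
    have hA0 : 0 ≤ A := le_trans (norm_nonneg _) (hAf 0 0 (by norm_num))
    linarith
  obtain ⟨hlo, hhi⟩ := klWindowC_margin hμ hA20
  exact ⟨fun m => contDiff_klFermiPoint B hAf hADt hlo hhi,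
    fun L M _ _ n m => contDiff_klLocalPart B hAf hADt hlo hhi L M β U n⟩

end Summit.HubbardSuperconductivity.HubbardSuperconductivity.Theorems.PerturbedFermiCurve

end
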